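import Mathlib
import HarnessLib
import Summits.Parity.GeneralizedHardyLittlewood.Theses.LeeYangFibres
import Literature.Barriers.Parity.SiegelZeroDichotomy

/-!
# Sketch — crux stmt-Parity-14116 (`LeeYangFibres.AbsoluteUpgrade := RelativeDimOne → DimOne`)
crux-ideate, round 1, ideator 1 (planner-cruxidea-stmt-Parity-14116-1-0).

First lemmas of the three crux idea cards, stated over existing declarations. `sorry` marks the statements the
cards propose (they need not be proved here); the pure-logic compositions are proved.

* card `nlc-cells-absolute-clip`: `nlc_clips_mixed_amplitude` (first lemma, real algebra), `CellNLC` (the conjectural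
  input), `jointCell` (the route's inlined cells).
* card `landau-page-split`: `not_unboundedSiegelZeros_of_relativeDimOne` (first lemma), `ZeroFreeBranch`,
  `absoluteUpgrade_of_split` (proved).
* card `dip-margin-rate-exchange`: `singularProduct_le_loglog_pow` (first lemma), `RelativeDimOneRate`,
  `dimOne_of_rate`, `absoluteUpgrade_of_dimOne` (proved).
-/

noncomputable section

open scoped BigOperators Classical
open Finset Filter

namespace Summit.Parity.GeneralizedHardyLittlewood.Cruxes.AbsoluteUpgrade.Ideator1

open Summit.Parity.GeneralizedHardyLittlewood.Theses.LeeYangFibres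
open Literature.NumberTheory.Sieve
open Literature.Barriers.Parity

/-! ## Common: the crux is discharged by any proof of `DimOne` -/

/-- `DimOne → AbsoluteUpgrade` (the hypothesis `RelativeDimOne` is then inert). [folklore] -/
theorem absoluteUpgrade_of_dimOne (hD : DimOne) : AbsoluteUpgrade := by
  unfold AbsoluteUpgrade
  intro _
  exact hD

/-! ## Card `nlc-cells-absolute-clip` -/

/-- Parity sign of an Ω-cell index, `σ(m) = (-1)^{m+1}` (so the prime cell `m = 1` has `σ = +1`). -/
def paritySign (m : ℕ) : ℝ := (-1 : ℝ) ^ (m + 1)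

/-- Walsh form of a normalised two-form cell at amplitudes `(θ₁, θ₂, θ₁₂)`:
`Θ(m,n) = 1 + θ₁σ(m) + θ₂σ(n) + θ₁₂σ(m)σ(n)` (the route's `Σ_S θ_S ∏_{i∈S} (-1)^{j_i+1}` at `t = 2`, `θ_∅ = 1`). -/
def walsh (θ₁ θ₂ θ₁₂ : ℝ) (m n : ℕ) : ℝ :=
  1 + θ₁ * paritySign m + θ₂ * paritySign n + θ₁₂ * paritySign m * paritySign n

/-- `|σ(m)| = 1`. [folklore] -/
theorem abs_paritySign (m : ℕ) : |paritySign m| = 1 := by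
  unfold paritySign; exact abs_neg_one_pow (m + 1)

/-- `σ(m+1) = -σ(m)`. [folklore] -/
theorem paritySign_succ (m : ℕ) : paritySign (m + 1) = -paritySign m := by
  rw [paritySign, paritySign, pow_succ]; ring

/-- `σ(m+2) = σ(m)`. [folklore] -/
theorem paritySign_add_two (m : ℕ) : paritySign (m + 2) = paritySign m := by
  rw [show m + 2 = m + 1 + 1 from rfl, paritySign_succ, paritySign_succ, neg_neg]

/-- `|Θ| ≤ 7` when all amplitudes are `≤ 2` (the law's bound `|θ_S| ≤ 2`). [folklore] -/
theorem abs_walsh_le {θ₁ θ₂ θ₁₂ : ℝ} (h₁ : |θ₁| ≤ 2) (h₂ : |θ₂| ≤ 2) (h₁₂ : |θ₁₂| ≤ 2)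
    (i j : ℕ) : |walsh θ₁ θ₂ θ₁₂ i j| ≤ 7 := by
  have hi := abs_paritySign i
  have hj := abs_paritySign j
  unfold walsh
  calc |1 + θ₁ * paritySign i + θ₂ * paritySign j + θ₁₂ * paritySign i * paritySign j|
      ≤ |1 + θ₁ * paritySign i + θ₂ * paritySign j| + |θ₁₂ * paritySign i * paritySign j| :=
        abs_add_le _ _
    _ ≤ |1 + θ₁ * paritySign i| + |θ₂ * paritySign j| + |θ₁₂ * paritySign i * paritySign j| := by
        gcongr; exact abs_add_le _ _
    _ ≤ |(1 : ℝ)| + |θ₁ * paritySign i| + |θ₂ * paritySign j| + |θ₁₂ * paritySign i * paritySign j| := by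
        gcongr; exact abs_add_le _ _
    _ = 1 + |θ₁| + |θ₂| + |θ₁₂| := by simp only [abs_mul, abs_one, hi, hj, mul_one]
    _ ≤ 7 := by linarith

/-- `|xy - XY| ≤ 2Bδ + δ²` if `x, y` are `δ`-close to `X, Y` with `|X|, |Y| ≤ B`. [folklore] -/
theorem abs_mul_sub_mul_le {x y X Y δ B : ℝ} (hx : |x - X| ≤ δ) (hy : |y - Y| ≤ δ) (hX : |X| ≤ B)
    (hY : |Y| ≤ B) (hδ : 0 ≤ δ) : |x * y - X * Y| ≤ 2 * B * δ + δ ^ 2 := by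
  have hB : 0 ≤ B := (abs_nonneg X).trans hX
  have key : x * y - X * Y = (x - X) * Y + X * (y - Y) + (x - X) * (y - Y) := by ring
  rw [key]
  calc |(x - X) * Y + X * (y - Y) + (x - X) * (y - Y)|
      ≤ |(x - X) * Y| + |X * (y - Y)| + |(x - X) * (y - Y)| := abs_add_three _ _ _
    _ = |x - X| * |Y| + |X| * |y - Y| + |x - X| * |y - Y| := by simp only [abs_mul]
    _ ≤ δ * B + B * δ + δ * δ := by gcongr
    _ = 2 * B * δ + δ ^ 2 := by ring

/-- **First lemma (card `nlc-cells-absolute-clip`), `t = 2` — PROVED.** Normalised cells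
`c m n = C_{(m,n)} / (M a_m a_n)` obeying the cell parity law to accuracy `δ` on the six indices
`{m, m+1, m+2} × {n, n+1}` and the approximate NEGATIVE LATTICE CONDITION
`c_{m+1,n+1} c_{m,n} ≤ c_{m+1,n} c_{m,n+1} + η` at the two index pairs `(m,n)` and `(m+1,n)` (opposite parity classes)
have their mixed amplitude clipped to the slack: `|θ₁₂ - θ₁θ₂| ≤ 8δ + η`, whatever the size of the amplitudes within
the law's a-priori bound `|θ_S| ≤ 2` (no smallness, no positivity needed). (Exact case: the two inequalities read
`±4σ(m)σ(n)(θ₁₂ - θ₁θ₂) ≤ 0`; the independent-anatomy model `θ = 0` is NLC-extremal, slack zero.) -/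
theorem nlc_clips_mixed_amplitude (θ₁ θ₂ θ₁₂ δ η : ℝ) (c : ℕ → ℕ → ℝ) (m n : ℕ)
    (hδ : 0 ≤ δ) (hδ1 : δ ≤ 1) (hη : 0 ≤ η)
    (h₁ : |θ₁| ≤ 2) (h₂ : |θ₂| ≤ 2) (h₁₂ : |θ₁₂| ≤ 2)
    (hlaw : ∀ i ∈ ({m, m + 1, m + 2} : Finset ℕ), ∀ j ∈ ({n, n + 1} : Finset ℕ),
      |c i j - walsh θ₁ θ₂ θ₁₂ i j| ≤ δ)
    (hnlc₁ : c (m + 1) (n + 1) * c m n ≤ c (m + 1) n * c m (n + 1) + η)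
    (hnlc₂ : c (m + 2) (n + 1) * c (m + 1) n ≤ c (m + 2) n * c (m + 1) (n + 1) + η) :
    |θ₁₂ - θ₁ * θ₂| ≤ 8 * δ + η := by
  -- the two parity signs
  obtain ⟨s, hs⟩ : ∃ s : ℝ, paritySign m = s := ⟨_, rfl⟩
  obtain ⟨s', hs'⟩ : ∃ s' : ℝ, paritySign n = s' := ⟨_, rfl⟩
  have hs1 : paritySign (m + 1) = -s := by rw [paritySign_succ, hs]
  have hs2 : paritySign (m + 2) = s := by rw [paritySign_add_two, hs]
  have hs1' : paritySign (n + 1) = -s' := by rw [paritySign_succ, hs']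
  have has : |s| = 1 := by rw [← hs]; exact abs_paritySign m
  have has' : |s'| = 1 := by rw [← hs']; exact abs_paritySign n
  -- the six Walsh values and their bounds
  have b00 := abs_walsh_le h₁ h₂ h₁₂ m n
  have b10 := abs_walsh_le h₁ h₂ h₁₂ (m + 1) n
  have b01 := abs_walsh_le h₁ h₂ h₁₂ m (n + 1)
  have b11 := abs_walsh_le h₁ h₂ h₁₂ (m + 1) (n + 1)
  have b20 := abs_walsh_le h₁ h₂ h₁₂ (m + 2) n
  have b21 := abs_walsh_le h₁ h₂ h₁₂ (m + 2) (n + 1)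
  have e00 := hlaw m (by simp) n (by simp)
  have e10 := hlaw (m + 1) (by simp) n (by simp)
  have e01 := hlaw m (by simp) (n + 1) (by simp)
  have e11 := hlaw (m + 1) (by simp) (n + 1) (by simp)
  have e20 := hlaw (m + 2) (by simp) n (by simp)
  have e21 := hlaw (m + 2) (by simp) (n + 1) (by simp)
  have W00 : walsh θ₁ θ₂ θ₁₂ m n = 1 + θ₁ * s + θ₂ * s' + θ₁₂ * s * s' := by
    simp only [walsh, hs, hs']
  have W10 : walsh θ₁ θ₂ θ₁₂ (m + 1) n = 1 - θ₁ * s + θ₂ * s' - θ₁₂ * s * s' := by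
    simp only [walsh, hs1, hs']; ring
  have W01 : walsh θ₁ θ₂ θ₁₂ m (n + 1) = 1 + θ₁ * s - θ₂ * s' - θ₁₂ * s * s' := by
    simp only [walsh, hs, hs1']; ring
  have W11 : walsh θ₁ θ₂ θ₁₂ (m + 1) (n + 1) = 1 - θ₁ * s - θ₂ * s' + θ₁₂ * s * s' := by
    simp only [walsh, hs1, hs1']; ring
  have W20 : walsh θ₁ θ₂ θ₁₂ (m + 2) n = 1 + θ₁ * s + θ₂ * s' + θ₁₂ * s * s' := by
    simp only [walsh, hs2, hs']
  have W21 : walsh θ₁ θ₂ θ₁₂ (m + 2) (n + 1) = 1 + θ₁ * s - θ₂ * s' - θ₁₂ * s * s' := by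
    simp only [walsh, hs2, hs1']; ring
  rw [W00] at b00 e00; rw [W10] at b10 e10; rw [W01] at b01 e01; rw [W11] at b11 e11
  rw [W20] at b20 e20; rw [W21] at b21 e21
  -- products
  have P1 := abs_mul_sub_mul_le e11 e00 b11 b00 hδ
  have P2 := abs_mul_sub_mul_le e10 e01 b10 b01 hδ
  have P3 := abs_mul_sub_mul_le e21 e10 b21 b10 hδ
  have P4 := abs_mul_sub_mul_le e20 e11 b20 b11 hδ
  -- the exact identity: the model is NLC-extremal, the mixed ghost tilts it by ±4σσ'(θ₁₂ - θ₁θ₂)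
  have key1 : (1 - θ₁ * s - θ₂ * s' + θ₁₂ * s * s') * (1 + θ₁ * s + θ₂ * s' + θ₁₂ * s * s') -
      (1 - θ₁ * s + θ₂ * s' - θ₁₂ * s * s') * (1 + θ₁ * s - θ₂ * s' - θ₁₂ * s * s') =
      4 * (s * s') * (θ₁₂ - θ₁ * θ₂) := by ring
  have key2 : (1 + θ₁ * s - θ₂ * s' - θ₁₂ * s * s') * (1 - θ₁ * s + θ₂ * s' - θ₁₂ * s * s') -
      (1 + θ₁ * s + θ₂ * s' + θ₁₂ * s * s') * (1 - θ₁ * s - θ₂ * s' + θ₁₂ * s * s') =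
      -(4 * (s * s') * (θ₁₂ - θ₁ * θ₂)) := by ring
  have up : 4 * (s * s') * (θ₁₂ - θ₁ * θ₂) ≤ η + 28 * δ + 2 * δ ^ 2 := by
    rw [← key1]
    obtain ⟨hP1, _⟩ := abs_le.mp P1
    obtain ⟨_, hP2⟩ := abs_le.mp P2
    linarith
  have low : -(4 * (s * s') * (θ₁₂ - θ₁ * θ₂)) ≤ η + 28 * δ + 2 * δ ^ 2 := by
    rw [← key2]
    obtain ⟨hP3, _⟩ := abs_le.mp P3
    obtain ⟨_, hP4⟩ := abs_le.mp P4
    linarith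
  have hab : |4 * (s * s') * (θ₁₂ - θ₁ * θ₂)| ≤ η + 28 * δ + 2 * δ ^ 2 :=
    abs_le.mpr ⟨by linarith, up⟩
  have h4 : |4 * (s * s') * (θ₁₂ - θ₁ * θ₂)| = 4 * |θ₁₂ - θ₁ * θ₂| := by
    rw [abs_mul, abs_mul, abs_mul, has, has']; norm_num
  rw [h4] at hab
  have hδ2 : δ ^ 2 ≤ δ := by nlinarith
  linarith [abs_nonneg (θ₁₂ - θ₁ * θ₂)]

/-- The route's joint rough cell `C_j(Ψ, K, N, u) = #{n ∈ K ∩ ℤ : N^{1/u} < P⁻(ψ_i(n)), Ω(ψ_i(n)) = j_i ∀ i}`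
(inlined exactly as in `LeeYangFibres.CellParityLaw` / `FibreHyperbolicity`). -/
def jointCell {t : ℕ} (Ψ : Fin t → AffLinForm 1) (K : Set (Fin 1 → ℝ)) (N u : ℕ) (j : Fin t → ℕ) : ℕ :=
  ((latticeBox 1 N).filter (fun n => realPoint n ∈ K ∧ ∀ i, (N : ℝ) ^ ((1 : ℝ) / u) <
      (Nat.minFac ((Ψ i).eval n).toNat : ℝ) ∧ ArithmeticFunction.cardFactors ((Ψ i).eval n).toNat = j i)).card

/-- **CellNLC** — the card's conjectural (non-sieve) input, replacing zero-locus hypotheses: the joint rough Ω-cells of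
the forms of a prime-tuple system are LOG-SUBMODULAR on the index lattice `[1,u]^t` (negative lattice condition /
multivariate reverse rule), up to an absolute slack `η (N / log^t N)²`, uniformly over admissible `(Ψ, K)` and roughness
`2 ≤ u ≤ log log N`:  `C_{j ⊔ j'} · C_{j ⊓ j'} ≤ C_j · C_{j'} + η (N/log^t N)²`.
Equality (slack 0) in the independent-anatomy model `M · ∏_i A_{j_i}(N)/N` (a product is modular: NLC-extremal); for the
exclusion heuristic (a prime `p > N^{1/u}` divides at most one form: count generating polynomial `∏_p ((1-ν_p/p) + p⁻¹Σ_i z_i)`,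
real stable) the adjacent instances hold exactly (Brändén's Rayleigh inequality at `0` applied to `∂^j`, constant 1) and the
general ones by chaining through positive cells; violated by a mixed parity ghost of EITHER sign (adjacent instances at `j`
resp. `j + e_i`) and by perfectly correlated ghosts (`t = 3`: `C_{222}C_{111} ≤ C_{211}C_{122}` fails for "all three forms have
equal parity"). Only the instances with `j, j' ∈ {1,2,3}^t` (the prime corner) are used by the line. -/
def CellNLC : Prop :=
  ∀ (t L : ℕ), 1 ≤ t → ∀ η : ℝ, 0 < η → ∃ N₀ : ℕ, ∀ N : ℕ, N₀ ≤ N →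
    ∀ u : ℕ, 2 ≤ u → (u : ℝ) ≤ Real.log (Real.log N) →
      ∀ Ψ : Fin t → AffLinForm 1, IsNondegenerateSystem Ψ → affLinSize Ψ N ≤ L →
        ∀ K : Set (Fin 1 → ℝ), Convex ℝ K → K ⊆ realBox 1 N →
          ∀ j j' : Fin t → ℕ, (∀ l, 1 ≤ j l ∧ j l ≤ u) → (∀ l, 1 ≤ j' l ∧ j' l ≤ u) →
            (jointCell Ψ K N u (j ⊔ j') : ℝ) * jointCell Ψ K N u (j ⊓ j') ≤
              (jointCell Ψ K N u j : ℝ) * jointCell Ψ K N u j' + η * ((N : ℝ) / Real.log N ^ t) ^ 2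

/-! ## Card `landau-page-split` -/

/-- **First lemma (card `landau-page-split`).** Relative Dickson–Hardy–Littlewood already excludes Siegel zeros of
unbounded quality: at a quality-`η` zero of conductor `q`, Matomäki–Merikoski Thm 1.3 doubles the main term of
`Σ_{n ≤ X} Λ(n)Λ(n+h)` at `h = q` (even `q`) or `h = 2q` (odd `q`), `X = q^{10}`, with error
`O((h/φ(h)) X (e^{-C√(10 log η)} + e^{-C (log X)^{0.59}} + 10 log⁶η/η))`, `h/φ(h) ≤ 1.52 𝔖_h`; against `RelativeDimOne` at
`t = 2, L = 4, ε = 1/10` (system `(n, n+h)`, `K = [1, X]`, `archFactor = X - 1`, `singularProduct = 𝔖_h ≥ 1.32`) this is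
impossible once `η ≥ η₀(K)` and `q ≥ q₀`. Provable now modulo the named fact and the pair-system dictionary
(cf. `LinearEquationsInPrimesTwinSystem.lean` for `h = 2`). -/
theorem not_unboundedSiegelZeros_of_relativeDimOne
    (hMM : MatomakiMerikoski2023_pairCorrelation) (hR : RelativeDimOne) :
    ¬ UnboundedSiegelZeros := by
  sorry

/-- The branch the line must then prove: OFF Siegel zeros of unbounded quality — equivalently
(`not_unboundedSiegelZeros_iff_zeroFree`) with a Landau–Page zero-free interval `[1 - 1/(η₀ log q), 1)` for every
primitive quadratic character of conductor `q ≥ q₀`, hence Gallagher's prime number theorem for all moduli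
`≤ exp(c √log N)` — relative accuracy upgrades to absolute. -/
def ZeroFreeBranch : Prop :=
  ¬ UnboundedSiegelZeros → RelativeDimOne → DimOne

/-- **The split** (pure logic, proved): `AbsoluteUpgrade` follows from the branch statement and the named fact —
in the other branch the hypothesis `RelativeDimOne` is false. -/
theorem absoluteUpgrade_of_split (hMM : MatomakiMerikoski2023_pairCorrelation) (hB : ZeroFreeBranch) :
    AbsoluteUpgrade := by
  unfold AbsoluteUpgrade
  intro hR
  exact hB (not_unboundedSiegelZeros_of_relativeDimOne hMM hR) hR

/-! ## Card `dip-margin-rate-exchange` -/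

/-- **First lemma (card `dip-margin-rate-exchange`): the exact size of the residual.** For non-degenerate `d = 1`
systems of `t` forms with `‖Ψ‖_N ≤ L`: `∏_p β_p ≤ C(t,L) (log log N)^{t-1}` for `N ≥ N₀` (collision primes divide the
non-zero minors `a_i b_k - a_k b_i`, `|·| ≤ 2L²N`; `β_p ≤ (p/(p-1))^{t-1}` at a collision prime `p ∤ a_i`, `β_p ≤ 1`
otherwise for `p ≥ 2t`, `p > 2L²`). Given the convergence of the ordered product (GT Lemma 1.3, the tree's named fact
`tendsto_singularProductPartial`). Provable now. -/
theorem singularProduct_le_loglog_pow (hconv : tendsto_singularProductPartial) (t L : ℕ) (ht : 1 ≤ t) :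
    ∃ C : ℝ, ∃ N₀ : ℕ, ∀ N : ℕ, N₀ ≤ N → ∀ Ψ : Fin t → AffLinForm 1, IsNondegenerateSystem Ψ →
      affLinSize Ψ N ≤ L → singularProduct Ψ ≤ C * Real.log (Real.log N) ^ (t - 1) := by
  sorry

/-- Relative Dickson–Hardy–Littlewood WITH A RATE `κ`: `|error| ≤ κ(N) · β_∞ ∏_p β_p + ε N`. (`RelativeDimOne` is the
rate-free `κ = ε`; the route's mechanism yields `κ(N) ≍ θ⋆(u(N)) + e^{-c u(N)}` once cruxes 2–3 hold for `u ≤ u(N)`.) -/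
def RelativeDimOneRate (κ : ℕ → ℝ) : Prop :=
  ∀ (t L : ℕ), 1 ≤ t → ∀ ε : ℝ, 0 < ε → ∃ N₀ : ℕ, ∀ N : ℕ, N₀ ≤ N → ∀ Ψ : Fin t → AffLinForm 1,
    IsNondegenerateSystem Ψ → affLinSize Ψ N ≤ L → ∀ K : Set (Fin 1 → ℝ), Convex ℝ K → K ⊆ realBox 1 N →
      |vonMangoldtSum Ψ K N - archFactor Ψ K * singularProduct Ψ| ≤
        κ N * (archFactor Ψ K * singularProduct Ψ) + ε * N

/-- **Rate exchange** (bookkeeping; provable now from `singularProduct_le_loglog_pow`, `0 ≤ ∏β_p` and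
`archFactor Ψ K ≤ vol(realBox 1 N) = 2N`): a relative rate beating every power of `log log N` gives `DimOne`, hence the
crux (`absoluteUpgrade_of_dimOne`). With `θ⋆(u) ≈ e^{-0.92u}` (siblings' exact tables through `u = 60`) the rate is met by
`u(N) = ⌈(A/0.92) log log log N⌉`. -/
theorem dimOne_of_rate (hconv : tendsto_singularProductPartial) (κ : ℕ → ℝ) (hκ0 : ∀ N, 0 ≤ κ N)
    (hκ : ∀ A : ℕ, Tendsto (fun N : ℕ => κ N * Real.log (Real.log N) ^ A) atTop (nhds 0))
    (hR : RelativeDimOneRate κ) : DimOne := by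
  sorry

end Summit.Parity.GeneralizedHardyLittlewood.Cruxes.AbsoluteUpgrade.Ideator1
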